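import Summits.CriticalPhenomena.PercolationContinuityZ3.Theorems.PercNearOneGluingNoHeavyLowerTailSahiColouredMSLifts
import Mathlib.Tactic
import HarnessLib
import HarnessLib.Audit.Tags

/-!
# `NoHeavyLowerTail` (crux stmt-CriticalPhenomena-4575), master-family line P1 (gen 28):
# coloured Marica–Schönheim for two colours, part 3/3 — THE THEOREM

Support file (seat `prim-masterthm-p1`, gen 28; `--supports stmt-CriticalPhenomena-4575`).  No definitions, no `sorry`, standard axioms.

**THEOREM (coloured Marica–Schönheim, two colours; `card_add_card_le_card_diffs_union`) [this work].**  For DISJOINT families `A, B` of finite sets,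
  `#A + #B ≤ #((A \\ A) ∪ (B \\ B) ∪ (A ⊼ B) ∪ (A ⊻ B))`:
differences WITHIN each colour class, intersections and unions ACROSS the classes pay for both classes.  `B = ∅` is the Marica–Schönheim inequality
`#A ≤ #(A \\ A)` (Mathlib `Finset.card_le_card_diffs`).  It is the `k = 2` case of the conjecture CMS_k (memo §8) and a sibling of gen 27's
`SignedColouredDaykin3` (neither implies the other).  PROOF: the typed statement `card_supp_le_card_credits` (`#supp ≤ #credits` for every
configuration over the six-letter system of part 1) by induction on the ground set — slice by a point `a`; the support splits exactly
(`card_supp_insert`), the credits split as single lifts + double lifts (`card_credits_insert`), and the two projected configurations' credits lift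
(`credits_proj₂_subset`, `credits_proj₁_subset`, part 2); base case `base_credit`.  Then colour `A` red and `B` blue.  Memo `run/shared/lean/prim/prim-masterthm/FROM-prim-masterthm-p1-g28-STRONG-DAYKIN.md` §9–§10 (typed Marica–Schönheim induction; the six-letter
system and the projection maps were found by the closure search `code-g28/typed/` and are checked here by the kernel). [this work]
-/

namespace Summit.CriticalPhenomena.PercolationContinuityZ3.Theorems.SahiColouredMS

open Finset
open scoped FinsetFamily
open Ty

variable {α : Type*} [DecidableEq α]

/-! ### 6. The induction -/

/-- Every present type credits the point at the base (`decide`d: a table diagonal or a self credit). [this work] -/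
theorem base_credit : ∀ x : Ty, pres x = true → (dT x x = true ∨ mT x x = true ∨ sT x = true) := by decide

/-- **The typed Marica–Schönheim theorem for the six-letter system**: `#supp ≤ #credits`. [this work] -/
theorem card_supp_le_card_credits (u : Finset α) : ∀ t : Finset α → Ty, #(supp u t) ≤ #(credits u t) := by
  induction u using Finset.induction with
  | empty =>
    intro t
    by_cases hp : pres (t ∅) = true
    · have hs : supp ∅ t = {∅} := by
        ext s; simp only [supp, powerset_empty, mem_filter, mem_singleton]
        constructor
        · rintro ⟨h, _⟩; exact h
        · rintro rfl; exact ⟨rfl, hp⟩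
      rw [hs, card_singleton]
      have hmem : (∅ : Finset α) ∈ supp ∅ t := by rw [hs]; exact mem_singleton_self _
      apply card_pos.2
      rcases base_credit _ hp with h | h | h
      · exact ⟨∅ \ ∅, sdiff_mem_credits hmem hmem h⟩
      · exact ⟨∅ ∩ ∅, inter_mem_credits hmem hmem h⟩
      · exact ⟨∅, self_mem_credits hmem h⟩
    · have hs : supp ∅ t = ∅ := by
        ext s; simp only [supp, powerset_empty, mem_filter, mem_singleton, notMem_empty, iff_false, not_and]
        rintro rfl; exact hp
      rw [hs, card_empty]; exact Nat.zero_le _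
  | insert a u hu ih =>
    intro t
    rw [card_supp_insert hu t, card_credits_insert hu t]
    exact Nat.add_le_add ((ih _).trans (card_le_card (credits_proj₂_subset hu t)))
      ((ih _).trans (card_le_card (credits_proj₁_subset hu t)))

/-! ### 7. The coloured Marica–Schönheim inequality for two colours -/

/-- **Coloured Marica–Schönheim, two colours.**  For disjoint families `A, B` of finite sets,
`#A + #B ≤ #((A \\ A) ∪ (B \\ B) ∪ (A ⊼ B) ∪ (A ⊻ B))`. [this work] -/
theorem card_add_card_le_card_diffs_union (A B : Finset (Finset α)) (hAB : Disjoint A B) :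
    #A + #B ≤ #((A \\ A) ∪ (B \\ B) ∪ (A ⊼ B) ∪ (A ⊻ B)) := by
  classical
  set u : Finset α := (A ∪ B).sup id with hu
  set t : Finset α → Ty := fun s => if s ∈ A then R else if s ∈ B then Ty.B else N with ht
  have hAu : ∀ s ∈ A, s ⊆ u := fun s hs => le_sup (f := id) (mem_union_left B hs)
  have hBu : ∀ s ∈ B, s ⊆ u := fun s hs => le_sup (f := id) (mem_union_right A hs)
  have tA : ∀ s ∈ A, t s = R := fun s hs => by simp [ht, hs]
  have tB : ∀ s ∈ B, t s = Ty.B := fun s hs => by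
    have : s ∉ A := fun h => disjoint_left.1 hAB h hs
    simp [ht, hs, this]
  have hsupp : supp u t = A ∪ B := by
    ext s
    simp only [mem_supp, mem_union]
    constructor
    · rintro ⟨_, hp⟩
      by_cases hA : s ∈ A
      · exact Or.inl hA
      · by_cases hB : s ∈ B
        · exact Or.inr hB
        · simp [ht, hA, hB, pres] at hp
    · rintro (h | h)
      · exact ⟨hAu s h, by rw [tA s h]; rfl⟩
      · exact ⟨hBu s h, by rw [tB s h]; rfl⟩
  have hcred : credits u t ⊆ (A \\ A) ∪ (B \\ B) ∪ (A ⊼ B) ∪ (A ⊻ B) := by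
    intro x hx
    rcases mem_credits_cases hx with ⟨z, hz, w, hw, h⟩ | ⟨hxs, hsx⟩
    · rw [hsupp] at hz hw
      simp only [mem_union]
      -- types of z and w
      rcases mem_union.1 hz with hzA | hzB <;> rcases mem_union.1 hw with hwA | hwB
      · rw [tA z hzA, tA w hwA] at h
        rcases h with ⟨_, rfl⟩ | ⟨hm, _⟩ | ⟨hj, _⟩
        · exact Or.inl (Or.inl (Or.inl (mem_diffs.2 ⟨z, hzA, w, hwA, rfl⟩)))
        · exact absurd hm (by decide)
        · exact absurd hj (by decide)
      · rw [tA z hzA, tB w hwB] at h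
        rcases h with ⟨hd, _⟩ | ⟨_, rfl⟩ | ⟨_, rfl⟩
        · exact absurd hd (by decide)
        · exact Or.inl (Or.inr (mem_infs.2 ⟨z, hzA, w, hwB, rfl⟩))
        · exact Or.inr (mem_sups.2 ⟨z, hzA, w, hwB, rfl⟩)
      · rw [tB z hzB, tA w hwA] at h
        rcases h with ⟨hd, _⟩ | ⟨_, rfl⟩ | ⟨_, rfl⟩
        · exact absurd hd (by decide)
        · refine Or.inl (Or.inr (mem_infs.2 ⟨w, hwA, z, hzB, ?_⟩)); exact inter_comm w z
        · refine Or.inr (mem_sups.2 ⟨w, hwA, z, hzB, ?_⟩); exact union_comm w z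
      · rw [tB z hzB, tB w hwB] at h
        rcases h with ⟨_, rfl⟩ | ⟨hm, _⟩ | ⟨hj, _⟩
        · exact Or.inl (Or.inl (Or.inr (mem_diffs.2 ⟨z, hzB, w, hwB, rfl⟩)))
        · exact absurd hm (by decide)
        · exact absurd hj (by decide)
    · rw [hsupp] at hxs
      rcases mem_union.1 hxs with h | h
      · rw [tA x h] at hsx; exact absurd hsx (by decide)
      · rw [tB x h] at hsx; exact absurd hsx (by decide)
  calc #A + #B = #(A ∪ B) := (card_union_of_disjoint hAB).symm
    _ = #(supp u t) := by rw [hsupp]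
    _ ≤ #(credits u t) := card_supp_le_card_credits u t
    _ ≤ _ := card_le_card hcred

end Summit.CriticalPhenomena.PercolationContinuityZ3.Theorems.SahiColouredMS
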